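import Summits.Ventures.HSemireg.Pad4TowerLineDesignCert12Closure

/-!
# Pad4Tower ∕ LineDesignCert12 — KERNEL DECIDES (5∕7, `XPlus2`): guarded X⁺ (the `X` family of the dual-0 world `cfgd`) at dual heads of chunks 21–40 of 78

Tree cut of the KERNEL CERTIFICATE `Cert12`: the `decide +kernel` theorems of this module are, by NAME, STATEMENT and PROOF, those of the farm-certified
Cruxes-level parts `CeilingLineCert12A–E` (split5); the module boundary is set by the gate's build budget only. Each theorem is one static-family check at a few
heads of the design `cfg` of `Pad4TowerLineDesignCert12Closure`; the assembly is in `Pad4TowerLineDesignCert12`.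

MODULE SET (tree cut of ONE certificate; one namespace `Summit.Ventures.HSemireg.Pad4Tower.LineDesignCert12`): `…Cert12DataN` ∕ `DataP` ∕ `DataPd` ∕ `DataNd` (the support and its literal
dual-0 world, DATA ONLY) → `…Cert12Closure` (key-chain `Nodup`, the design `cfg`, the literal dual `cfgd` and `cfg_dual_eq`, ◇₁₂, the ceiling line, per-chunk
G₁ closure ⇒ `cfg` is Δ- and S₄-closed) → `…Cert12RuleD1` ∕ `…Cert12RuleD2` ∕ `…Cert12RuleD3` ∕ `…Cert12XPlus1` ∕ `…Cert12XPlus2` ∕ `…Cert12XPlus3` ∕ `…Cert12XPlus4` (the RULE D (μ₄, M) resp. guarded X⁺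
decides, a few heads per theorem, module boundaries set by the gate's build budget only) → `Pad4TowerLineDesignCert12` (assembly `cfg_staticH1` and the
UNCONDITIONAL doors `¬ SeedB1OddDiamondG1H1 12`, `¬ SeedB1OddConeG1H1`, `¬ SeedB1OddDiamondG1H1 h'` (12 ≤ h'), the LINE shape, every support cell's realisability).

NOTHING IN THIS MODULE SET SAYS THAT HC ∕ HC_CM ∕ HC_AV ∕ H2 ∕ stmt-HodgeConjecture-18881 HOLDS OR FAILS (HC_CM is a displayed binder of the
ladder only); the certified statements concern the typed FIRST-ORDER static game (`RuleDMu4Closed`, `XPlusClosed`, `A2IMinusClosed` = `MConfig.StaticH1`)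
of ONE explicit finite support — first order is necessary, not sufficient, for a seed; no σ, no seed, no census row. `decide +kernel` only: NO `native_decide`,
no `sorry`, no `axiom`, no `instance`, no notation, no Literature fact, no new `def … : Prop`.
-/

set_option linter.dupNamespace false

namespace Summit.Ventures.HSemireg.Pad4Tower.LineDesignCert12

open Summit.Ventures.HSemireg Summit.Ventures.HSemireg.Pad4Tower

set_option maxRecDepth 32768
set_option Elab.async false
set_option synthInstance.maxSize 8192
set_option synthInstance.maxHeartbeats 2000000
set_option maxHeartbeats 8000000

/-! guarded X⁺ (the `X` family of the dual-0 world `cfgd`), heads chunked (6 per theorem) -/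

/-- no `X`-family instance of the dual-0 world fires at the heads of dual chunk 21∕78 (guarded form, `xresXClosed_iff_guarded'`). [kernel `decide`] -/
theorem xplus_21 : ∀ Z ∈ lPd_21, ∀ σ : Fin 4, ¬ isApex (Z σ) → ∀ u : Fin 4, ∀ q ∈ sNd, UPartner Z q σ u → ∀ w : Fin 4, ∀ n ∈ sPd,
    Sibling q n σ w → ∀ f : Fin 4, ¬ XresXFires cfgd Z q n σ u w f := by decide +kernel
/-- no `X`-family instance of the dual-0 world fires at the heads of dual chunk 22∕78 (guarded form, `xresXClosed_iff_guarded'`). [kernel `decide`] -/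
theorem xplus_22 : ∀ Z ∈ lPd_22, ∀ σ : Fin 4, ¬ isApex (Z σ) → ∀ u : Fin 4, ∀ q ∈ sNd, UPartner Z q σ u → ∀ w : Fin 4, ∀ n ∈ sPd,
    Sibling q n σ w → ∀ f : Fin 4, ¬ XresXFires cfgd Z q n σ u w f := by decide +kernel
/-- no `X`-family instance of the dual-0 world fires at the heads of dual chunk 23∕78 (guarded form, `xresXClosed_iff_guarded'`). [kernel `decide`] -/
theorem xplus_23 : ∀ Z ∈ lPd_23, ∀ σ : Fin 4, ¬ isApex (Z σ) → ∀ u : Fin 4, ∀ q ∈ sNd, UPartner Z q σ u → ∀ w : Fin 4, ∀ n ∈ sPd,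
    Sibling q n σ w → ∀ f : Fin 4, ¬ XresXFires cfgd Z q n σ u w f := by decide +kernel
/-- no `X`-family instance of the dual-0 world fires at the heads of dual chunk 24∕78 (guarded form, `xresXClosed_iff_guarded'`). [kernel `decide`] -/
theorem xplus_24 : ∀ Z ∈ lPd_24, ∀ σ : Fin 4, ¬ isApex (Z σ) → ∀ u : Fin 4, ∀ q ∈ sNd, UPartner Z q σ u → ∀ w : Fin 4, ∀ n ∈ sPd,
    Sibling q n σ w → ∀ f : Fin 4, ¬ XresXFires cfgd Z q n σ u w f := by decide +kernel
/-- no `X`-family instance of the dual-0 world fires at the heads of dual chunk 25∕78 (guarded form, `xresXClosed_iff_guarded'`). [kernel `decide`] -/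
theorem xplus_25 : ∀ Z ∈ lPd_25, ∀ σ : Fin 4, ¬ isApex (Z σ) → ∀ u : Fin 4, ∀ q ∈ sNd, UPartner Z q σ u → ∀ w : Fin 4, ∀ n ∈ sPd,
    Sibling q n σ w → ∀ f : Fin 4, ¬ XresXFires cfgd Z q n σ u w f := by decide +kernel
/-- no `X`-family instance of the dual-0 world fires at the heads of dual chunk 26∕78 (guarded form, `xresXClosed_iff_guarded'`). [kernel `decide`] -/
theorem xplus_26 : ∀ Z ∈ lPd_26, ∀ σ : Fin 4, ¬ isApex (Z σ) → ∀ u : Fin 4, ∀ q ∈ sNd, UPartner Z q σ u → ∀ w : Fin 4, ∀ n ∈ sPd,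
    Sibling q n σ w → ∀ f : Fin 4, ¬ XresXFires cfgd Z q n σ u w f := by decide +kernel
/-- no `X`-family instance of the dual-0 world fires at the heads of dual chunk 27∕78 (guarded form, `xresXClosed_iff_guarded'`). [kernel `decide`] -/
theorem xplus_27 : ∀ Z ∈ lPd_27, ∀ σ : Fin 4, ¬ isApex (Z σ) → ∀ u : Fin 4, ∀ q ∈ sNd, UPartner Z q σ u → ∀ w : Fin 4, ∀ n ∈ sPd,
    Sibling q n σ w → ∀ f : Fin 4, ¬ XresXFires cfgd Z q n σ u w f := by decide +kernel
/-- no `X`-family instance of the dual-0 world fires at the heads of dual chunk 28∕78 (guarded form, `xresXClosed_iff_guarded'`). [kernel `decide`] -/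
theorem xplus_28 : ∀ Z ∈ lPd_28, ∀ σ : Fin 4, ¬ isApex (Z σ) → ∀ u : Fin 4, ∀ q ∈ sNd, UPartner Z q σ u → ∀ w : Fin 4, ∀ n ∈ sPd,
    Sibling q n σ w → ∀ f : Fin 4, ¬ XresXFires cfgd Z q n σ u w f := by decide +kernel
/-- no `X`-family instance of the dual-0 world fires at the heads of dual chunk 29∕78 (guarded form, `xresXClosed_iff_guarded'`). [kernel `decide`] -/
theorem xplus_29 : ∀ Z ∈ lPd_29, ∀ σ : Fin 4, ¬ isApex (Z σ) → ∀ u : Fin 4, ∀ q ∈ sNd, UPartner Z q σ u → ∀ w : Fin 4, ∀ n ∈ sPd,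
    Sibling q n σ w → ∀ f : Fin 4, ¬ XresXFires cfgd Z q n σ u w f := by decide +kernel
/-- no `X`-family instance of the dual-0 world fires at the heads of dual chunk 30∕78 (guarded form, `xresXClosed_iff_guarded'`). [kernel `decide`] -/
theorem xplus_30 : ∀ Z ∈ lPd_30, ∀ σ : Fin 4, ¬ isApex (Z σ) → ∀ u : Fin 4, ∀ q ∈ sNd, UPartner Z q σ u → ∀ w : Fin 4, ∀ n ∈ sPd,
    Sibling q n σ w → ∀ f : Fin 4, ¬ XresXFires cfgd Z q n σ u w f := by decide +kernel
/-- no `X`-family instance of the dual-0 world fires at the heads of dual chunk 31∕78 (guarded form, `xresXClosed_iff_guarded'`). [kernel `decide`] -/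
theorem xplus_31 : ∀ Z ∈ lPd_31, ∀ σ : Fin 4, ¬ isApex (Z σ) → ∀ u : Fin 4, ∀ q ∈ sNd, UPartner Z q σ u → ∀ w : Fin 4, ∀ n ∈ sPd,
    Sibling q n σ w → ∀ f : Fin 4, ¬ XresXFires cfgd Z q n σ u w f := by decide +kernel
/-- no `X`-family instance of the dual-0 world fires at the heads of dual chunk 32∕78 (guarded form, `xresXClosed_iff_guarded'`). [kernel `decide`] -/
theorem xplus_32 : ∀ Z ∈ lPd_32, ∀ σ : Fin 4, ¬ isApex (Z σ) → ∀ u : Fin 4, ∀ q ∈ sNd, UPartner Z q σ u → ∀ w : Fin 4, ∀ n ∈ sPd,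
    Sibling q n σ w → ∀ f : Fin 4, ¬ XresXFires cfgd Z q n σ u w f := by decide +kernel
/-- no `X`-family instance of the dual-0 world fires at the heads of dual chunk 33∕78 (guarded form, `xresXClosed_iff_guarded'`). [kernel `decide`] -/
theorem xplus_33 : ∀ Z ∈ lPd_33, ∀ σ : Fin 4, ¬ isApex (Z σ) → ∀ u : Fin 4, ∀ q ∈ sNd, UPartner Z q σ u → ∀ w : Fin 4, ∀ n ∈ sPd,
    Sibling q n σ w → ∀ f : Fin 4, ¬ XresXFires cfgd Z q n σ u w f := by decide +kernel
/-- no `X`-family instance of the dual-0 world fires at the heads of dual chunk 34∕78 (guarded form, `xresXClosed_iff_guarded'`). [kernel `decide`] -/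
theorem xplus_34 : ∀ Z ∈ lPd_34, ∀ σ : Fin 4, ¬ isApex (Z σ) → ∀ u : Fin 4, ∀ q ∈ sNd, UPartner Z q σ u → ∀ w : Fin 4, ∀ n ∈ sPd,
    Sibling q n σ w → ∀ f : Fin 4, ¬ XresXFires cfgd Z q n σ u w f := by decide +kernel
/-- no `X`-family instance of the dual-0 world fires at the heads of dual chunk 35∕78 (guarded form, `xresXClosed_iff_guarded'`). [kernel `decide`] -/
theorem xplus_35 : ∀ Z ∈ lPd_35, ∀ σ : Fin 4, ¬ isApex (Z σ) → ∀ u : Fin 4, ∀ q ∈ sNd, UPartner Z q σ u → ∀ w : Fin 4, ∀ n ∈ sPd,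
    Sibling q n σ w → ∀ f : Fin 4, ¬ XresXFires cfgd Z q n σ u w f := by decide +kernel
/-- no `X`-family instance of the dual-0 world fires at the heads of dual chunk 36∕78 (guarded form, `xresXClosed_iff_guarded'`). [kernel `decide`] -/
theorem xplus_36 : ∀ Z ∈ lPd_36, ∀ σ : Fin 4, ¬ isApex (Z σ) → ∀ u : Fin 4, ∀ q ∈ sNd, UPartner Z q σ u → ∀ w : Fin 4, ∀ n ∈ sPd,
    Sibling q n σ w → ∀ f : Fin 4, ¬ XresXFires cfgd Z q n σ u w f := by decide +kernel
/-- no `X`-family instance of the dual-0 world fires at the heads of dual chunk 37∕78 (guarded form, `xresXClosed_iff_guarded'`). [kernel `decide`] -/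
theorem xplus_37 : ∀ Z ∈ lPd_37, ∀ σ : Fin 4, ¬ isApex (Z σ) → ∀ u : Fin 4, ∀ q ∈ sNd, UPartner Z q σ u → ∀ w : Fin 4, ∀ n ∈ sPd,
    Sibling q n σ w → ∀ f : Fin 4, ¬ XresXFires cfgd Z q n σ u w f := by decide +kernel
/-- no `X`-family instance of the dual-0 world fires at the heads of dual chunk 38∕78 (guarded form, `xresXClosed_iff_guarded'`). [kernel `decide`] -/
theorem xplus_38 : ∀ Z ∈ lPd_38, ∀ σ : Fin 4, ¬ isApex (Z σ) → ∀ u : Fin 4, ∀ q ∈ sNd, UPartner Z q σ u → ∀ w : Fin 4, ∀ n ∈ sPd,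
    Sibling q n σ w → ∀ f : Fin 4, ¬ XresXFires cfgd Z q n σ u w f := by decide +kernel
/-- no `X`-family instance of the dual-0 world fires at the heads of dual chunk 39∕78 (guarded form, `xresXClosed_iff_guarded'`). [kernel `decide`] -/
theorem xplus_39 : ∀ Z ∈ lPd_39, ∀ σ : Fin 4, ¬ isApex (Z σ) → ∀ u : Fin 4, ∀ q ∈ sNd, UPartner Z q σ u → ∀ w : Fin 4, ∀ n ∈ sPd,
    Sibling q n σ w → ∀ f : Fin 4, ¬ XresXFires cfgd Z q n σ u w f := by decide +kernel
/-- no `X`-family instance of the dual-0 world fires at the heads of dual chunk 40∕78 (guarded form, `xresXClosed_iff_guarded'`). [kernel `decide`] -/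
theorem xplus_40 : ∀ Z ∈ lPd_40, ∀ σ : Fin 4, ¬ isApex (Z σ) → ∀ u : Fin 4, ∀ q ∈ sNd, UPartner Z q σ u → ∀ w : Fin 4, ∀ n ∈ sPd,
    Sibling q n σ w → ∀ f : Fin 4, ¬ XresXFires cfgd Z q n σ u w f := by decide +kernel

end Summit.Ventures.HSemireg.Pad4Tower.LineDesignCert12
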